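import Literature.MathematicalPhysics.QuantumManyBody.GroundState
import HarnessLib

/-!
# Route `BECHeatBathGap`, crux `SquareSummableInfluence` (stmt-AtomisticToContinuum-14368),
# line `registered`: the registered stub `stub_groundStateApprox`

Supports (does not close) stmt-AtomisticToContinuum-14368; stub `stub_groundStateApprox` of line
`registered` (skeleton v2).

**A ground state has near-minimisers of every slack that are `L²`-close to it.** If `Ψ₀` is a
ground state of `H_N` in the box `Λ_L` (`IsGroundState v L Ψ₀`), then for every slack `δ > 0` and
every `η > 0` there is an admissible trial state `Φ` with
`⟨Φ, H_N Φ⟩ ≤ E₀(N, L) + δ` and `∫ |Φ − Ψ₀|² ≤ η`.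

## Proof

`E₀ := E₀(N, L) < ⊤` (a ground state exists) and `q̄[Ψ₀] = E₀ < E₀ + δ`. Unfolding the closed
energy `q̄[Ψ₀] = inf { liminfₙ ⟨Φₙ, H_N Φₙ⟩ : Φₙ → Ψ₀ in L² }` (`iInf_lt_iff` twice) gives a sequence
of trial states `Φₙ → Ψ₀` in `L²` with `liminfₙ ⟨Φₙ, H_N Φₙ⟩ < E₀ + δ`; hence frequently
`⟨Φₙ, H_N Φₙ⟩ < E₀ + δ` (`frequently_lt_of_liminf_lt`) while eventually `∫ |Φₙ − Ψ₀|² ≤ η`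
(`ENNReal.tendsto_nhds_zero`); any index where both hold does it.

No new definitions; `[cite: Kato1966, VI §1.3 Thm 1.16]` (the closed form is the envelope of the
form on its core) and `[folklore]`.
-/

noncomputable section

open MeasureTheory Filter
open scoped ENNReal NNReal

namespace Summit.AtomisticToContinuum.BoseEinsteinCondensation.Theorems.SquareSummableInfluence

open Literature.MathematicalPhysics.QuantumManyBody.BoseGas

/-! ### The stub -/

/-- **Stub 5 (S, frame) of line `registered` (skeleton v2) of the crux `SquareSummableInfluence`:
a ground state has near-minimisers of every slack that are `L²`-close to it.** If
`IsGroundState v L Ψ₀`, then for every `δ > 0` and `η > 0` there is a trial state `Φ` with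
`energy v Φ ≤ E₀(N, L) + δ` and `∫ |Φ − Ψ₀|² ≤ η` (`q̄[Ψ₀] = E₀ < E₀ + δ`, unfold the infimum
defining the closed form, `frequently_lt_of_liminf_lt` and `L²`-convergence).
[cite: Kato1966, VI §1.3 Thm 1.16] -/
theorem stub_groundStateApprox :
    ∀ (N : ℕ) (L : ℝ) (v : ℝ → ℝ≥0∞) (Ψ₀ : Config N → ℂ), IsGroundState v L Ψ₀ →
      ∀ δ : ℝ≥0∞, 0 < δ → ∀ η : ℝ, 0 < η →
        ∃ Φ : TrialState N L, energy v Φ ≤ groundStateEnergy v N L + δ ∧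
          ∫⁻ X, (‖Φ.ψ X - Ψ₀ X‖₊ : ℝ≥0∞) ^ 2 ≤ ENNReal.ofReal η := by
  intro N L v Ψ₀ hgs δ hδ η hη
  -- the ground-state energy `E₀ < ⊤` and `q̄[Ψ₀] = E₀ < E₀ + δ`
  have hE : groundStateEnergy v N L ≠ ⊤ := hgs.groundStateEnergy_ne_top
  have hlt : closedEnergy v L Ψ₀ < groundStateEnergy v N L + δ := by
    rw [hgs.closedEnergy_eq]
    exact ENNReal.lt_add_right hE hδ.ne'
  -- an approximating sequence of trial states with `liminf` of energies `< E₀ + δ`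
  obtain ⟨Φ, hΦ⟩ := iInf_lt_iff.1 hlt
  obtain ⟨hΦΨ, hlim⟩ := iInf_lt_iff.1 hΦ
  -- frequently the energy is below `E₀ + δ`
  have hfreq : ∃ᶠ n in atTop, energy v (Φ n) < groundStateEnergy v N L + δ :=
    frequently_lt_of_liminf_lt (h := hlim)
  -- eventually `∫ |Φₙ − Ψ₀|² ≤ η`
  have hev : ∀ᶠ n in atTop,
      ∫⁻ X, (‖(Φ n).ψ X - Ψ₀ X‖₊ : ℝ≥0∞) ^ 2 ≤ ENNReal.ofReal η :=
    ENNReal.tendsto_nhds_zero.1 hΦΨ _ (ENNReal.ofReal_pos.2 hη)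
  obtain ⟨n, hnE, hnd⟩ := (hfreq.and_eventually hev).exists
  exact ⟨Φ n, hnE.le, hnd⟩

end Summit.AtomisticToContinuum.BoseEinsteinCondensation.Theorems.SquareSummableInfluence
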